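import Summits.CriticalPhenomena.PercolationContinuityZ3.Theorems.PercNearOneGluingNoHeavyLowerTailKnQuestion8CoefficientwiseRemSP
import Summits.CriticalPhenomena.PercolationContinuityZ3.Theorems.PercNearOneGluingNoHeavyLowerTailKnQuestion8CoefficientwiseRemOneSum
import HarnessLib

/-!
# THEOREM SP with a decoration: a series–parallel root block glued to an arbitrary piece at one vertex — prim-lf-2 gen 69

Support file (`--supports stmt-CriticalPhenomena-4575`, closed), prover `prim-lf-2` (gen 69).  No definitions, no named facts, no sorries; standard axioms.
Memo `prim-lf-2/CW-SP-gen69.md` §5.1 (COROLLARY): THEOREM SP (`rem_nonneg_seriesParallel`, …RemSP.lean) combined with the cut-vertex identity of gen 68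
(`rem_nonneg_oneSum`, …RemOneSum.lean): (REM) holds for every target set on `E ∪ D` when `E ∖ e` is two-terminal series–parallel (terminals = ends of `e`) and `D` is an
ARBITRARY edge set glued to `E` at a single vertex `v` (targets inside `D` allowed).  Iterating over the block–cut tree gives (REM) whenever the root-edge block is
series–parallel; this file records the one-step version.
* `Coefficientwise.rem_nonneg_seriesParallel_oneSum`.
[cite: KozmaNitzan2024, Questions 8–9 (§5.5 p. 36) (context: the Question-8 pocket covariance programme)]
-/

namespace Summit.CriticalPhenomena.PercolationContinuityZ3.Theorems

open Finset Literature.Probability.Percolation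

namespace Coefficientwise

variable {ι V : Type*} [DecidableEq ι] (ends : ι → Sym2 V)

open Classical in
/-- **THEOREM SP + one decoration.**  Let `e ∈ E` have ends `{x,p}`, `p ≠ x`, with `E ∖ e` two-terminal series–parallel (terminals `x, p`); let `D` be disjoint from `E`,
its edges meeting those of `E` only at the vertex `v` and avoiding `x` unless `x = v`; targets `W₁` off `D` (except at `v`) and `W₂` inside `D` (off `E`, `x ∉ W₂`).
Then `0 ≤ REM_{E ∪ D}(e; x, W₁ ∪ W₂)[g]` for every monotone `g`. [cite: KozmaNitzan2024, Questions 8–9 (§5.5 p. 36) (context)] -/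
theorem rem_nonneg_seriesParallel_oneSum {E D : Finset ι} (hED : Disjoint E D) {x p v : V} {e : ι} (he : e ∈ E)
    (hxp : ends e = s(x, p)) (hpx : p ≠ x) (hsp : IsSP2T ends (E.erase e) x p)
    (hsep : ∀ e₁ ∈ E, ∀ e' ∈ D, ∀ w : V, w ∈ ends e₁ → w ∈ ends e' → w = v)
    (hx : ∀ e' ∈ D, x ∈ ends e' → x = v) (W₁ W₂ : Set V) (hW₁ : ∀ e' ∈ D, ∀ w ∈ W₁, w ∈ ends e' → w = v)
    (hW₂ : ∀ e₁ ∈ E, ∀ w ∈ W₂, w ∉ ends e₁) (hxW₂ : x ∉ W₂) (g : Set V → ℝ) (hg : Monotone g) :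
    0 ≤ ∑ r ∈ (E ∪ D).powerset.filter (fun r : Finset ι => e ∈ r ∧
          ∀ w ∈ W₁ ∪ W₂, ¬ (w ∈ openCluster (ends '' (↑r : Set ι)) x ∧ w ∈ openCluster (ends '' (↑((E ∪ D) \ r) : Set ι)) x)),
      (g (openCluster (ends '' (↑r : Set ι)) x) - g (openCluster (ends '' (↑((E ∪ D) \ r) : Set ι)) x)) :=
  rem_nonneg_oneSum ends hED he hsep hx W₁ W₂ hW₁ hW₂ hxW₂
    (fun W' φ hφ => rem_nonneg_seriesParallel ends E he hxp hpx hsp W' φ hφ) g hg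

/-! ### Arbitrary decorations: graphs whose root-edge block is series–parallel -/

/-- `IsDecoratedSP ends E x e`: the edge set `E` with root `x` and root edge `e` is obtained from a two-terminal series–parallel root block (`E₀ ∖ e` SP with terminals the
ends `x, p` of `e`) by successively gluing ARBITRARY edge sets at single vertices (each new piece `D` meets the current edge set in at most one vertex `v`, and
avoids `x` unless `x = v`).  Every finite connected multigraph whose root-edge block is `e ∥ (SP piece)` is of this form. -/
inductive IsDecoratedSP (ends : ι → Sym2 V) : Finset ι → V → ι → Prop
  | base {E : Finset ι} {x p : V} {e : ι} (he : e ∈ E) (hxp : ends e = s(x, p)) (hpx : p ≠ x) (hsp : IsSP2T ends (E.erase e) x p) :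
      IsDecoratedSP ends E x e
  | glue {E D : Finset ι} {x v : V} {e : ι} (hED : Disjoint E D)
      (hsep : ∀ e₁ ∈ E, ∀ e' ∈ D, ∀ w : V, w ∈ ends e₁ → w ∈ ends e' → w = v) (hx : ∀ e' ∈ D, x ∈ ends e' → x = v)
      (h : IsDecoratedSP ends E x e) : IsDecoratedSP ends (E ∪ D) x e

/-- The root edge belongs to a decorated SP edge set. [folklore] -/
theorem IsDecoratedSP.root_mem {E : Finset ι} {x : V} {e : ι} (h : IsDecoratedSP ends E x e) : e ∈ E := by
  induction h with
  | base he _ _ _ => exact he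
  | glue _ _ _ _ ih => exact Finset.mem_union_left _ ih

open Classical in
/-- **THEOREM SP for graphs whose root-edge block is series–parallel.**  If `E` is obtained from a two-terminal series–parallel root block by gluing arbitrary pieces at
single vertices (`IsDecoratedSP ends E x e`), then for EVERY target set `W` and every monotone `g`:
`0 ≤ REM_E(e; x, W)[g] = Σ_{s ⊆ E : e ∈ s, ∀ w∈W ¬(w ∈ C_x s ∧ w ∈ C_x(E∖s))} (g(C_x s) − g(C_x(E∖s)))`.  (THEOREM SP `rem_nonneg_seriesParallel` + the cut-vertex identity
`rem_nonneg_oneSum` of gen 68, iterated; at each step the target set is split into the targets on the new piece and the rest; for `x ∈ W` the sum is empty.)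
[cite: KozmaNitzan2024, Questions 8–9 (§5.5 p. 36) (context)] -/
theorem rem_nonneg_of_isDecoratedSP {E : Finset ι} {x : V} {e : ι} (h : IsDecoratedSP ends E x e) (W : Set V)
    (g : Set V → ℝ) (hg : Monotone g) :
    0 ≤ ∑ s ∈ E.powerset.filter (fun s : Finset ι => e ∈ s ∧
          ∀ w ∈ W, ¬ (w ∈ openCluster (ends '' (↑s : Set ι)) x ∧ w ∈ openCluster (ends '' (↑(E \ s) : Set ι)) x)),
      (g (openCluster (ends '' (↑s : Set ι)) x) - g (openCluster (ends '' (↑(E \ s) : Set ι)) x)) := by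
  induction h generalizing W g with
  | base he hxp hpx hsp => exact rem_nonneg_seriesParallel ends _ he hxp hpx hsp W g hg
  | @glue E D x v e hED hsep hx h ih =>
    by_cases hxW : x ∈ W
    · -- the event is empty: `x` lies in both clusters
      rw [Finset.sum_filter]
      refine Finset.sum_nonneg fun s _ => ?_
      split_ifs with hc
      · exact absurd ⟨mem_openCluster_self _ x, mem_openCluster_self _ x⟩ (hc.2 x hxW)
      · exact le_rfl
    -- split the targets: W₂ = targets on an edge of D away from v, W₁ = the rest
    set W₂ : Set V := {w | w ∈ W ∧ ∃ e' ∈ D, w ∈ ends e' ∧ w ≠ v} with hW₂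
    set W₁ : Set V := {w | w ∈ W ∧ ∀ e' ∈ D, w ∈ ends e' → w = v} with hW₁
    have hWW : W₁ ∪ W₂ = W := by
      ext w
      simp only [hW₁, hW₂, Set.mem_union, Set.mem_setOf_eq]
      constructor
      · rintro (⟨hw, _⟩ | ⟨hw, _⟩) <;> exact hw
      · intro hw
        by_cases hc : ∀ e' ∈ D, w ∈ ends e' → w = v
        · exact Or.inl ⟨hw, hc⟩
        · push Not at hc
          obtain ⟨e', he', hwe', hne⟩ := hc
          exact Or.inr ⟨hw, e', he', hwe', hne⟩
    have hW₁D : ∀ e' ∈ D, ∀ w ∈ W₁, w ∈ ends e' → w = v := fun e' he' w hw hwe' => hw.2 e' he' hwe'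
    have hW₂E : ∀ e₁ ∈ E, ∀ w ∈ W₂, w ∉ ends e₁ := by
      intro e₁ he₁ w hw hwe₁
      obtain ⟨_, e', he', hwe', hne⟩ := hw
      exact hne (hsep e₁ he₁ e' he' w hwe₁ hwe')
    have hxW₂ : x ∉ W₂ := fun hx2 => hxW hx2.1
    have key := rem_nonneg_oneSum ends hED h.root_mem hsep hx W₁ W₂ hW₁D hW₂E hxW₂ (fun W' φ hφ => ih W' φ hφ) g hg
    rw [hWW] at key
    exact key

end Coefficientwise

end Summit.CriticalPhenomena.PercolationContinuityZ3.Theorems
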